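import Summits.KontsevichZagierPeriods.KontsevichZagierPeriods.Theorems.HurwitzMicroSectorsHurwitzSectorComplementStubLadderDescentSteps

/-!
# `HurwitzSectorComplement` (stmt-KontsevichZagierPeriods-14341), line `chebyshev-level-deformation`,
# stub S3 `stub_ladderDescent` — the descent by well-founded recursion on the weight

Def-free. This file closes the registered stub `stub_ladderDescent` (verbatim signature of the lead
skeleton `Cruxes/HurwitzSectorComplement/Lines/chebyshev_level_deformation.lean`, sha `35ae5381f713`)
on top of the landed parts 1–3 (`…StubLadderDescentAlgebra/Engine/Steps.lean`: the `ℚ·𝔭`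
bookkeeping, the engine S1 instantiated on the chain cells `(0,1)^m × Δ_k(tan(πj/L))`, the
`ζ(even)`-trick at `v₀ = 1`, the T-objects and conclusion (C1)).

What is added here is the recursion itself. Write `𝔘(d)` for "every U-object
`[(0,1)^d × Δ_{k+1}(tan(πj/L)), (∏ 2/(1+y_i²))·U(y₀, x₀⋯x_{d−1})]` lies in `ℚ·𝔭`" and `Z(d)` for
"`[(0,1)^d, 1/(1−x₀⋯x_{d−1})] ∈ ℚ·𝔭_d`". The ladder only ever visits ODD box dimensions with the
kernel `U` and EVEN ones with `T` (Bernoulli parity), and the weight strictly drops at every step: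

* `𝔘(1)` is the bottom cell S2b (`LadderDescent.base_of_bottomCell`);
* `𝔘(d+2) ⇐ 𝔘(d)`: one U-step of the engine (`ladder_U`) turns a U-object over `(0,1)^{d+2}` into a
  T-object over `(0,1)^{d+1}`, which `step_T` reduces to `Z(d+1)` (itself `⇐ 𝔘(d)` by `step_zeta`,
  the ladder at `v₀ = 1 = tan(π/4)`), to S2a, and to `𝔘(d)` (`LadderDescent.wf_uStep`);

so `𝔘(d)` for all odd `d` follows by well-founded (two-step structural) recursion on `d`
(`LadderDescent.wf_uObjects`). The four descents of the stub are then read off: (C3) `Z(w)`, `w`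
even, is `step_zeta` over `𝔘(w−1)`; (C4) is `conc_inv` over (C3); (C1) is `conc_T` over (C3) and
`𝔘(w−1)`; (C2), `w ≥ 3` odd, is the first U-step `ladder_U0` followed by `step_T` over `Z(w−1)` and
`𝔘(w−2)` (the registered sub-goal `ladderDescent_uBoxes`).

References: M. Kontsevich, D. Zagier, *Periods*, in: Mathematics Unlimited — 2001 and Beyond,
Springer (2001), §1.2 (rules (1)–(3), Conjecture 1).
-/

noncomputable section

open Set MeasureTheory
open scoped BigOperators
open Literature.NumberTheory.Transcendental

namespace Summit.KontsevichZagierPeriods.Theorems.HurwitzMicroSectorsHurwitzSectorComplement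

namespace LadderDescent

section Engine

variable (hT :
    (∀ (m k : ℕ) (D : Set (Fin k → ℝ)) (W lam : (Fin k → ℝ) → ℝ) (M Λ : ℝ),
      Literature.ModelTheory.ExponentialFields.IsSemialgebraic ℚ D → Bornology.IsBounded D →
      IsSemialgebraicFunOn ℚ D W → IsSemialgebraicFunOn ℚ D lam →
      (∀ y ∈ D, |W y| ≤ M) → (∀ y ∈ D, 0 < lam y ∧ lam y ≤ Λ) →
      ∀ (r : KZ.IntegralRep (m + 2 + k)),
        r.domain = {z | (∀ i : Fin (m + 2), z (Fin.castAdd k i) ∈ Set.Ioo (0:ℝ) 1) ∧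
          (fun j : Fin k => z (Fin.natAdd (m + 2) j)) ∈ D} →
        Set.EqOn r.integrand (fun z => W (fun j : Fin k => z (Fin.natAdd (m + 2) j)) *
          (((1 - ∏ i : Fin (m + 2), z (Fin.castAdd k i)) -
              (lam (fun j : Fin k => z (Fin.natAdd (m + 2) j))) ^ 2 *
                (1 + ∏ i : Fin (m + 2), z (Fin.castAdd k i))) /
            ((1 - ∏ i : Fin (m + 2), z (Fin.castAdd k i)) ^ 2 +
              (lam (fun j : Fin k => z (Fin.natAdd (m + 2) j))) ^ 2 *
                (1 + ∏ i : Fin (m + 2), z (Fin.castAdd k i)) ^ 2))) r.domain →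
        ∃ (r₁ : KZ.IntegralRep (m + 2 + k)) (r₂ : KZ.IntegralRep (m + 1 + (k + 1))),
          r₁.domain = r.domain ∧
          (r₁.integrand = fun z => W (fun j : Fin k => z (Fin.natAdd (m + 2) j)) /
            (1 - ∏ i : Fin (m + 2), z (Fin.castAdd k i))) ∧
          r₂.domain = {z | (∀ i : Fin (m + 1), z (Fin.castAdd (k + 1) i) ∈ Set.Ioo (0:ℝ) 1) ∧
            (fun j : Fin k => z (Fin.natAdd (m + 1) j.succ)) ∈ D ∧
            0 < z (Fin.natAdd (m + 1) 0) ∧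
            z (Fin.natAdd (m + 1) 0) < lam ((fun j : Fin k => z (Fin.natAdd (m + 1) j.succ)))} ∧
          (r₂.integrand = fun z => W ((fun j : Fin k => z (Fin.natAdd (m + 1) j.succ))) *
            (2 / (1 + (z (Fin.natAdd (m + 1) 0)) ^ 2)) *
            (2 * z (Fin.natAdd (m + 1) 0) /
              ((1 - ∏ i : Fin (m + 1), z (Fin.castAdd (k + 1) i)) ^ 2 +
                (z (Fin.natAdd (m + 1) 0)) ^ 2 * (1 + ∏ i : Fin (m + 1), z (Fin.castAdd (k + 1) i)) ^ 2))) ∧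
          KZ.of r - KZ.of r₁ + KZ.of r₂ ∈ KZ.relations))

variable (hU :
    (∀ (m k : ℕ) (D : Set (Fin k → ℝ)) (W lam : (Fin k → ℝ) → ℝ) (M Λ : ℝ),
      Literature.ModelTheory.ExponentialFields.IsSemialgebraic ℚ D → Bornology.IsBounded D →
      IsSemialgebraicFunOn ℚ D W → IsSemialgebraicFunOn ℚ D lam →
      (∀ y ∈ D, |W y| ≤ M) → (∀ y ∈ D, 0 < lam y ∧ lam y ≤ Λ) →
      ∀ (r : KZ.IntegralRep (m + 2 + k)),
        r.domain = {z | (∀ i : Fin (m + 2), z (Fin.castAdd k i) ∈ Set.Ioo (0:ℝ) 1) ∧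
          (fun j : Fin k => z (Fin.natAdd (m + 2) j)) ∈ D} →
        Set.EqOn r.integrand (fun z => W (fun j : Fin k => z (Fin.natAdd (m + 2) j)) *
          (2 * lam (fun j : Fin k => z (Fin.natAdd (m + 2) j)) /
            ((1 - ∏ i : Fin (m + 2), z (Fin.castAdd k i)) ^ 2 +
              (lam (fun j : Fin k => z (Fin.natAdd (m + 2) j))) ^ 2 *
                (1 + ∏ i : Fin (m + 2), z (Fin.castAdd k i)) ^ 2))) r.domain →
        ∃ (r₂ : KZ.IntegralRep (m + 1 + (k + 1))),
          r₂.domain = {z | (∀ i : Fin (m + 1), z (Fin.castAdd (k + 1) i) ∈ Set.Ioo (0:ℝ) 1) ∧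
            (fun j : Fin k => z (Fin.natAdd (m + 1) j.succ)) ∈ D ∧
            0 < z (Fin.natAdd (m + 1) 0) ∧
            z (Fin.natAdd (m + 1) 0) < lam ((fun j : Fin k => z (Fin.natAdd (m + 1) j.succ)))} ∧
          (r₂.integrand = fun z => W ((fun j : Fin k => z (Fin.natAdd (m + 1) j.succ))) *
            (2 / (1 + (z (Fin.natAdd (m + 1) 0)) ^ 2)) *
            (((1 - ∏ i : Fin (m + 1), z (Fin.castAdd (k + 1) i)) -
                (z (Fin.natAdd (m + 1) 0)) ^ 2 * (1 + ∏ i : Fin (m + 1), z (Fin.castAdd (k + 1) i))) /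
              ((1 - ∏ i : Fin (m + 1), z (Fin.castAdd (k + 1) i)) ^ 2 +
                (z (Fin.natAdd (m + 1) 0)) ^ 2 * (1 + ∏ i : Fin (m + 1), z (Fin.castAdd (k + 1) i)) ^ 2))) ∧
          KZ.of r - KZ.of r₂ ∈ KZ.relations))

variable (hA1 :
    (∀ (a j₀ j₁ L : ℕ), j₀ < j₁ → 2 * j₁ < L → ∀ (r : KZ.IntegralRep a),
      r.domain = {y | (∀ i, Real.tan (Real.pi * j₀ / L) < y i ∧ y i < Real.tan (Real.pi * j₁ / L)) ∧
        (∀ i i' : Fin a, i < i' → y i < y i')} →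
      Set.EqOn r.integrand (fun y => ∏ i, 2 / (1 + (y i) ^ 2)) r.domain →
      ∃ q : ℚ, ∀ (s : KZ.IntegralRep a), s.domain = {x | ∀ i, x i ∈ Set.Ioo (0:ℝ) 1} →
        Set.EqOn s.integrand (fun x => (q : ℝ) * ∏ i, 2 / (1 + (x i) ^ 2)) s.domain →
        KZ.Equivalent r s))

variable (hBot :
    (∀ (k j L : ℕ), 0 < j → 2 * j < L → ∀ (r : KZ.IntegralRep (1 + (k + 1))),
      r.domain = {z | z (Fin.castAdd (k + 1) 0) ∈ Set.Ioo (0:ℝ) 1 ∧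
        (∀ i : Fin (k + 1), 0 < z (Fin.natAdd 1 i) ∧ z (Fin.natAdd 1 i) < Real.tan (Real.pi * j / L)) ∧
        (∀ i i' : Fin (k + 1), i < i' → z (Fin.natAdd 1 i) < z (Fin.natAdd 1 i'))} →
      Set.EqOn r.integrand (fun z => (∏ i : Fin (k + 1), 2 / (1 + (z (Fin.natAdd 1 i)) ^ 2)) *
        (2 * z (Fin.natAdd 1 0) /
          ((1 - z (Fin.castAdd (k + 1) 0)) ^ 2 +
            (z (Fin.natAdd 1 0)) ^ 2 * (1 + z (Fin.castAdd (k + 1) 0)) ^ 2))) r.domain →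
      ∃ q : ℚ, ∀ (s : KZ.IntegralRep (1 + (k + 1))), s.domain = {x | ∀ i, x i ∈ Set.Ioo (0:ℝ) 1} →
        Set.EqOn s.integrand (fun x => (q : ℝ) * ∏ i, 2 / (1 + (x i) ^ 2)) s.domain →
        KZ.Equivalent r s))

include hT hU hA1 in
/-- **The recursion step `𝔘(N+3) ⇐ 𝔘(N+1)`** (two rungs of the ladder, weight strictly dropping):
a U-object over `(0,1)^{N+3} × Δ_{k+1}(tan(πj/L))` becomes, by one U-step of the engine
(`ladder_U`), a T-object over `(0,1)^{N+2} × Δ_{k+2}`, which `step_T` splits into the peeled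
Fubini product `[(0,1)^{N+2}, 1/(1−p)] × [Δ_{k+2}, ∏ω]` (in `ℚ·𝔭` by `step_zeta` over `𝔘(N+1)`
and by S2a) and a U-object over `(0,1)^{N+1} × Δ_{k+3}` (in `ℚ·𝔭` by `𝔘(N+1)`).
[cite: KontsevichZagier2001, §1.2] -/
theorem wf_uStep (N : ℕ)
    (hUU : ∀ (k j L : ℕ), 0 < j → 2 * j < L → ∀ (r : KZ.IntegralRep (N + 1 + (k + 1))),
      r.domain = {z | (∀ i : Fin (N + 1), z (Fin.castAdd (k + 1) i) ∈ Set.Ioo (0:ℝ) 1) ∧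
        (∀ i : Fin (k + 1), 0 < z (Fin.natAdd (N + 1) i) ∧ z (Fin.natAdd (N + 1) i) < Real.tan (Real.pi * j / L)) ∧
        (∀ i i' : Fin (k + 1), i < i' → z (Fin.natAdd (N + 1) i) < z (Fin.natAdd (N + 1) i'))} →
      Set.EqOn r.integrand (fun z => (∏ i : Fin (k + 1), 2 / (1 + (z (Fin.natAdd (N + 1) i)) ^ 2)) *
        (2 * z (Fin.natAdd (N + 1) 0) /
          ((1 - ∏ i : Fin (N + 1), z (Fin.castAdd (k + 1) i)) ^ 2 + (z (Fin.natAdd (N + 1) 0)) ^ 2 * (1 + ∏ i : Fin (N + 1), z (Fin.castAdd (k + 1) i)) ^ 2))) r.domain →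
      ∃ q : ℚ, ∀ (s : KZ.IntegralRep (N + 1 + (k + 1))), s.domain = {x | ∀ i, x i ∈ Set.Ioo (0:ℝ) 1} →
        Set.EqOn s.integrand (fun x => (q : ℝ) * ∏ i, 2 / (1 + (x i) ^ 2)) s.domain →
        KZ.Equivalent r s) :
    ∀ (k j L : ℕ), 0 < j → 2 * j < L → ∀ (r : KZ.IntegralRep (N + 2 + 1 + (k + 1))),
      r.domain = {z | (∀ i : Fin (N + 2 + 1), z (Fin.castAdd (k + 1) i) ∈ Set.Ioo (0:ℝ) 1) ∧
        (∀ i : Fin (k + 1), 0 < z (Fin.natAdd (N + 2 + 1) i) ∧ z (Fin.natAdd (N + 2 + 1) i) < Real.tan (Real.pi * j / L)) ∧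
        (∀ i i' : Fin (k + 1), i < i' → z (Fin.natAdd (N + 2 + 1) i) < z (Fin.natAdd (N + 2 + 1) i'))} →
      Set.EqOn r.integrand (fun z => (∏ i : Fin (k + 1), 2 / (1 + (z (Fin.natAdd (N + 2 + 1) i)) ^ 2)) *
        (2 * z (Fin.natAdd (N + 2 + 1) 0) /
          ((1 - ∏ i : Fin (N + 2 + 1), z (Fin.castAdd (k + 1) i)) ^ 2 + (z (Fin.natAdd (N + 2 + 1) 0)) ^ 2 * (1 + ∏ i : Fin (N + 2 + 1), z (Fin.castAdd (k + 1) i)) ^ 2))) r.domain →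
      ∃ q : ℚ, ∀ (s : KZ.IntegralRep (N + 2 + 1 + (k + 1))), s.domain = {x | ∀ i, x i ∈ Set.Ioo (0:ℝ) 1} →
        Set.EqOn s.integrand (fun x => (q : ℝ) * ∏ i, 2 / (1 + (x i) ^ 2)) s.domain →
        KZ.Equivalent r s := by
  intro k j L hj hjL r hdom hint
  -- one U-step: `(0,1)^{N+3} × Δ_{k+1} ⟶ (0,1)^{N+2} × Δ_{k+2}` (a T-object)
  obtain ⟨r₂, h2d, h2i, hrel⟩ := ladder_U hU (N + 1) k j L hj hjL r hdom hint
  -- `Z(N+2)` by the ladder at `v₀ = 1` over `𝔘(N+1)`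
  have hZ := step_zeta hT N hUU
  -- the T-object is in `ℚ·𝔭` by `step_T`
  have h2 := step_T hT hA1 N hZ hUU (k + 1) j L hj hjL r₂ h2d h2i
  exact inQP_of_equivalent hrel (inQP_cast (by omega) h2)

include hT hU hA1 hBot in
/-- **`𝔘(N+1)` for every even `N`, by well-founded recursion on the weight.** Every U-object
`[(0,1)^{N+1} × Δ_{k+1}(tan(πj/L)), (∏ 2/(1+y_i²))·2y₀/((1−p)² + y₀²(1+p)²)]` with `N` even
(odd box dimension — the only ones the Bernoulli-parity ladder visits with the kernel `U`) lies
in `ℚ·𝔭`: the base `N = 0` is the bottom cell S2b (`base_of_bottomCell`), and `wf_uStep` descends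
`N + 2 ↦ N`. [cite: KontsevichZagier2001, §1.2] -/
theorem wf_uObjects : ∀ (N : ℕ), Even N →
    ∀ (k j L : ℕ), 0 < j → 2 * j < L → ∀ (r : KZ.IntegralRep (N + 1 + (k + 1))),
      r.domain = {z | (∀ i : Fin (N + 1), z (Fin.castAdd (k + 1) i) ∈ Set.Ioo (0:ℝ) 1) ∧
        (∀ i : Fin (k + 1), 0 < z (Fin.natAdd (N + 1) i) ∧ z (Fin.natAdd (N + 1) i) < Real.tan (Real.pi * j / L)) ∧
        (∀ i i' : Fin (k + 1), i < i' → z (Fin.natAdd (N + 1) i) < z (Fin.natAdd (N + 1) i'))} →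
      Set.EqOn r.integrand (fun z => (∏ i : Fin (k + 1), 2 / (1 + (z (Fin.natAdd (N + 1) i)) ^ 2)) *
        (2 * z (Fin.natAdd (N + 1) 0) /
          ((1 - ∏ i : Fin (N + 1), z (Fin.castAdd (k + 1) i)) ^ 2 + (z (Fin.natAdd (N + 1) 0)) ^ 2 * (1 + ∏ i : Fin (N + 1), z (Fin.castAdd (k + 1) i)) ^ 2))) r.domain →
      ∃ q : ℚ, ∀ (s : KZ.IntegralRep (N + 1 + (k + 1))), s.domain = {x | ∀ i, x i ∈ Set.Ioo (0:ℝ) 1} →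
        Set.EqOn s.integrand (fun x => (q : ℝ) * ∏ i, 2 / (1 + (x i) ^ 2)) s.domain →
        KZ.Equivalent r s
  | 0, _ => base_of_bottomCell hBot
  | 1, h => absurd h (by decide)
  | N + 2, h =>
    wf_uStep hT hU hA1 N (wf_uObjects N (by obtain ⟨t, ht⟩ := h; exact ⟨t - 1, by omega⟩))

include hT hU hA1 hBot in
/-- **(C3) `ζ(even)`**: `[(0,1)^{N+2}, 1/(1−p)] ∈ ℚ·𝔭_{N+2}` for even `N` — `step_zeta` (the ladder
at `v₀ = 1 = tan(π/4)` and the level-4 dilation algebra) over `𝔘(N+1)` (`wf_uObjects`).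
[cite: KontsevichZagier2001, §1.2] -/
theorem wf_zeta (N : ℕ) (hN : Even N) :
    ∀ (r : KZ.IntegralRep (N + 2)), r.domain = {x | ∀ i, x i ∈ Set.Ioo (0:ℝ) 1} →
      Set.EqOn r.integrand (fun x => 1 / (1 - ∏ i, x i)) r.domain →
      ∃ q : ℚ, ∀ (s : KZ.IntegralRep (N + 2)), s.domain = {x | ∀ i, x i ∈ Set.Ioo (0:ℝ) 1} →
        Set.EqOn s.integrand (fun x => (q : ℝ) * ∏ i, 2 / (1 + (x i) ^ 2)) s.domain →
        KZ.Equivalent r s :=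
  step_zeta hT N (wf_uObjects hT hU hA1 hBot N hN)

include hT hU hA1 hBot in
/-- **(C1) the Chebyshev `T`-boxes**: `[(0,1)^{N+2}, T(tan(πj/L), p)] ∈ ℚ·𝔭_{N+2}` for even `N`
(`conc_T` over (C3) and `𝔘(N+1)`). [cite: KontsevichZagier2001, §1.2] -/
theorem wf_T (N : ℕ) (hN : Even N) :
    ∀ (j L : ℕ), 0 < j → 2 * j < L → ∀ (r : KZ.IntegralRep (N + 2)), r.domain = {x | ∀ i, x i ∈ Set.Ioo (0:ℝ) 1} →
      Set.EqOn r.integrand (fun x =>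
        (((1 - ∏ i, x i) - (Real.tan (Real.pi * j / L)) ^ 2 * (1 + ∏ i, x i)) /
          ((1 - ∏ i, x i) ^ 2 + (Real.tan (Real.pi * j / L)) ^ 2 * (1 + ∏ i, x i) ^ 2))) r.domain →
      ∃ q : ℚ, ∀ (s : KZ.IntegralRep (N + 2)), s.domain = {x | ∀ i, x i ∈ Set.Ioo (0:ℝ) 1} →
        Set.EqOn s.integrand (fun x => (q : ℝ) * ∏ i, 2 / (1 + (x i) ^ 2)) s.domain →
        KZ.Equivalent r s :=
  conc_T hT N (wf_zeta hT hU hA1 hBot N hN) (wf_uObjects hT hU hA1 hBot N hN)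

end Engine

end LadderDescent

/-! ## Registered sub-goal -/

/-- **Registered sub-goal `ladderDescent_uBoxes`** (line `chebyshev-level-deformation`, stub S3, descent
(C2)): from the U-step of the engine S1 and the T-objects of the ladder in `ℚ·𝔭` over every
even-dimensional box `(0,1)^{N+2} × Δ_{k+1}(tan(πj/L))`, the Chebyshev `U`-boxes
`[(0,1)^w, 2v₀/((1−p)² + v₀²(1+p)²)]`, `v₀ = tan(πj/L)`, `w ≥ 3` odd, are rational multiples of `𝔭_w`:
write `w = N + 3` with `N` even; the first U-step (`LadderDescent.ladder_U0`) lands on a T-object over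
`(0,1)^{N+2} × Δ₁`. [cite: KontsevichZagier2001, §1.2] -/
theorem ladderDescent_uBoxes : (∀ (m k : ℕ) (D : Set (Fin k → ℝ)) (W lam : (Fin k → ℝ) → ℝ) (M Λ : ℝ), Literature.ModelTheory.ExponentialFields.IsSemialgebraic ℚ D → Bornology.IsBounded D → IsSemialgebraicFunOn ℚ D W → IsSemialgebraicFunOn ℚ D lam → (∀ y ∈ D, |W y| ≤ M) → (∀ y ∈ D, 0 < lam y ∧ lam y ≤ Λ) → ∀ (r : KZ.IntegralRep (m + 2 + k)), r.domain = {z | (∀ i : Fin (m + 2), z (Fin.castAdd k i) ∈ Set.Ioo (0:ℝ) 1) ∧ (fun j : Fin k => z (Fin.natAdd (m + 2) j)) ∈ D} → Set.EqOn r.integrand (fun z => W (fun j : Fin k => z (Fin.natAdd (m + 2) j)) * (2 * lam (fun j : Fin k => z (Fin.natAdd (m + 2) j)) / ((1 - ∏ i : Fin (m + 2), z (Fin.castAdd k i)) ^ 2 + (lam (fun j : Fin k => z (Fin.natAdd (m + 2) j))) ^ 2 * (1 + ∏ i : Fin (m + 2), z (Fin.castAdd k i)) ^ 2))) r.domain →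 ∃ (r₂ : KZ.IntegralRep (m + 1 + (k + 1))), r₂.domain = {z | (∀ i : Fin (m + 1), z (Fin.castAdd (k + 1) i) ∈ Set.Ioo (0:ℝ) 1) ∧ (fun j : Fin k => z (Fin.natAdd (m + 1) j.succ)) ∈ D ∧ 0 < z (Fin.natAdd (m + 1) 0) ∧ z (Fin.natAdd (m + 1) 0) < lam ((fun j : Fin k => z (Fin.natAdd (m + 1) j.succ)))} ∧ (r₂.integrand = fun z => W ((fun j : Fin k => z (Fin.natAdd (m + 1) j.succ))) * (2 / (1 + (z (Fin.natAdd (m + 1) 0)) ^ 2)) * (((1 - ∏ i : Fin (m + 1), z (Fin.castAdd (k + 1) i)) - (z (Fin.natAdd (m + 1) 0)) ^ 2 * (1 + ∏ i : Fin (m + 1), z (Fin.castAdd (k + 1) i))) / ((1 - ∏ i : Fin (m + 1), z (Fin.castAdd (k + 1) i)) ^ 2 + (z (Fin.natAdd (m + 1) 0)) ^ 2 * (1 + ∏ i : Fin (m + 1), z (Fin.castAdd (k + 1) i)) ^ 2))) ∧ KZ.of r - KZ.of r₂ ∈ KZ.relations) → (∀ (N : ℕ), Even N → ∀ (k j L :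 ℕ), 0 < j → 2 * j < L → ∀ (r : KZ.IntegralRep (N + 2 + (k + 1))), r.domain = {z | (∀ i : Fin (N + 2), z (Fin.castAdd (k + 1) i) ∈ Set.Ioo (0:ℝ) 1) ∧ (∀ i : Fin (k + 1), 0 < z (Fin.natAdd (N + 2) i) ∧ z (Fin.natAdd (N + 2) i) < Real.tan (Real.pi * j / L)) ∧ (∀ i i' : Fin (k + 1), i < i' → z (Fin.natAdd (N + 2) i) < z (Fin.natAdd (N + 2) i'))} → Set.EqOn r.integrand (fun z => (∏ i : Fin (k + 1), 2 / (1 + (z (Fin.natAdd (N + 2) i)) ^ 2)) * (((1 - ∏ i : Fin (N + 2), z (Fin.castAdd (k + 1) i)) - (z (Fin.natAdd (N + 2) 0)) ^ 2 * (1 + ∏ i : Fin (N + 2), z (Fin.castAdd (k + 1) i))) / ((1 - ∏ i : Fin (N + 2), z (Fin.castAdd (k + 1) i)) ^ 2 + (z (Fin.natAdd (N + 2) 0)) ^ 2 * (1 + ∏ i : Fin (N + 2), z (Fin.castAdd (k + 1) i)) ^ 2))) r.domain → ∃ q : ℚ, ∀ (s : KZ.IntegralRep (N + 2 + (k + 1))),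 s.domain = {x | ∀ i, x i ∈ Set.Ioo (0:ℝ) 1} → Set.EqOn s.integrand (fun x => (q : ℝ) * ∏ i, 2 / (1 + (x i) ^ 2)) s.domain → KZ.Equivalent r s) → ∀ (w j L : ℕ), 3 ≤ w → Odd w → 0 < j → 2 * j < L → ∀ (r : KZ.IntegralRep w), r.domain = {x | ∀ i, x i ∈ Set.Ioo (0:ℝ) 1} → Set.EqOn r.integrand (fun x => 2 * Real.tan (Real.pi * j / L) / ((1 - ∏ i, x i) ^ 2 + (Real.tan (Real.pi * j / L)) ^ 2 * (1 + ∏ i, x i) ^ 2)) r.domain → ∃ q : ℚ, ∀ (s : KZ.IntegralRep w), s.domain = {x | ∀ i, x i ∈ Set.Ioo (0:ℝ) 1} → Set.EqOn s.integrand (fun x => (q : ℝ) * ∏ i, 2 / (1 + (x i) ^ 2)) s.domain → KZ.Equivalent r s := by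
  intro hU hTT w j L hw hwo hj hjL
  obtain ⟨N, rfl⟩ : ∃ N, w = N + 1 + 2 := ⟨w - 3, by omega⟩
  have hN : Even N := by obtain ⟨t, ht⟩ := hwo; exact ⟨t - 1, by omega⟩
  intro r hdom hint
  obtain ⟨r₂, h2d, h2i, hrel⟩ := LadderDescent.ladder_U0 hU (N + 1) j L hj hjL r hdom hint
  exact LadderDescent.inQP_of_equivalent hrel
    (LadderDescent.inQP_cast (by omega) (hTT N hN 0 j L hj hjL r₂ h2d h2i))

/-! ## The stub, by name and signature -/

/-- **S3, ladder descent** (registered stub `stub_ladderDescent` of the lead skeleton of line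
`chebyshev-level-deformation`, crux `HurwitzSectorComplement`, verbatim signature). From the engine
S1, the arcs S2a and the bottom cell S2b: for cyclotomic half-angles `v₀ = tan(πj/L)` (`0 < j`,
`2j < L`) the Chebyshev box representations `[(0,1)^w, T(v₀, x₁⋯x_w)]` (`w ≥ 2` even) and
`[(0,1)^w, U(v₀, x₁⋯x_w)]` (`w ≥ 3` odd), and the level-1/2 representations `[(0,1)^w, 1/(1−t)]`,
`[(0,1)^w, 1/(1+t)]` (`w ≥ 2` even), are KZ-equivalent to RATIONAL multiples of
`𝔭_w = [(0,1)^w, ∏ 2/(1+x_i²)]`. Proof: well-founded recursion on the weight — the U-objects over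
odd-dimensional boxes are in `ℚ·𝔭` by `LadderDescent.wf_uObjects` (each recursion step is two rungs
of the ladder and strictly lowers the box dimension, bottoming out in S2b), and the four descents
are `LadderDescent.wf_T`, `ladderDescent_uBoxes`, `wf_zeta` and `conc_inv ∘ wf_zeta` after writing
`w = N + 2` (resp. `w = N + 3`) with `N` even. [cite: KontsevichZagier2001, §1.2] -/
theorem stub_ladderDescent :
    -- S1 (engine), verbatim
    ((∀ (m k : ℕ) (D : Set (Fin k → ℝ)) (W lam : (Fin k → ℝ) → ℝ) (M Λ : ℝ),
      Literature.ModelTheory.ExponentialFields.IsSemialgebraic ℚ D → Bornology.IsBounded D →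
      IsSemialgebraicFunOn ℚ D W → IsSemialgebraicFunOn ℚ D lam →
      (∀ y ∈ D, |W y| ≤ M) → (∀ y ∈ D, 0 < lam y ∧ lam y ≤ Λ) →
      ∀ (r : KZ.IntegralRep (m + 2 + k)),
        r.domain = {z | (∀ i : Fin (m + 2), z (Fin.castAdd k i) ∈ Set.Ioo (0:ℝ) 1) ∧
          (fun j : Fin k => z (Fin.natAdd (m + 2) j)) ∈ D} →
        Set.EqOn r.integrand (fun z => W (fun j : Fin k => z (Fin.natAdd (m + 2) j)) *
          (((1 - ∏ i : Fin (m + 2), z (Fin.castAdd k i)) -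
              (lam (fun j : Fin k => z (Fin.natAdd (m + 2) j))) ^ 2 *
                (1 + ∏ i : Fin (m + 2), z (Fin.castAdd k i))) /
            ((1 - ∏ i : Fin (m + 2), z (Fin.castAdd k i)) ^ 2 +
              (lam (fun j : Fin k => z (Fin.natAdd (m + 2) j))) ^ 2 *
                (1 + ∏ i : Fin (m + 2), z (Fin.castAdd k i)) ^ 2))) r.domain →
        ∃ (r₁ : KZ.IntegralRep (m + 2 + k)) (r₂ : KZ.IntegralRep (m + 1 + (k + 1))),
          r₁.domain = r.domain ∧
          (r₁.integrand = fun z => W (fun j : Fin k => z (Fin.natAdd (m + 2) j)) /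
            (1 - ∏ i : Fin (m + 2), z (Fin.castAdd k i))) ∧
          r₂.domain = {z | (∀ i : Fin (m + 1), z (Fin.castAdd (k + 1) i) ∈ Set.Ioo (0:ℝ) 1) ∧
            (fun j : Fin k => z (Fin.natAdd (m + 1) j.succ)) ∈ D ∧
            0 < z (Fin.natAdd (m + 1) 0) ∧
            z (Fin.natAdd (m + 1) 0) < lam ((fun j : Fin k => z (Fin.natAdd (m + 1) j.succ)))} ∧
          (r₂.integrand = fun z => W ((fun j : Fin k => z (Fin.natAdd (m + 1) j.succ))) *
            (2 / (1 + (z (Fin.natAdd (m + 1) 0)) ^ 2)) *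
            (2 * z (Fin.natAdd (m + 1) 0) /
              ((1 - ∏ i : Fin (m + 1), z (Fin.castAdd (k + 1) i)) ^ 2 +
                (z (Fin.natAdd (m + 1) 0)) ^ 2 * (1 + ∏ i : Fin (m + 1), z (Fin.castAdd (k + 1) i)) ^ 2))) ∧
          KZ.of r - KZ.of r₁ + KZ.of r₂ ∈ KZ.relations) ∧
    (∀ (m k : ℕ) (D : Set (Fin k → ℝ)) (W lam : (Fin k → ℝ) → ℝ) (M Λ : ℝ),
      Literature.ModelTheory.ExponentialFields.IsSemialgebraic ℚ D → Bornology.IsBounded D →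
      IsSemialgebraicFunOn ℚ D W → IsSemialgebraicFunOn ℚ D lam →
      (∀ y ∈ D, |W y| ≤ M) → (∀ y ∈ D, 0 < lam y ∧ lam y ≤ Λ) →
      ∀ (r : KZ.IntegralRep (m + 2 + k)),
        r.domain = {z | (∀ i : Fin (m + 2), z (Fin.castAdd k i) ∈ Set.Ioo (0:ℝ) 1) ∧
          (fun j : Fin k => z (Fin.natAdd (m + 2) j)) ∈ D} →
        Set.EqOn r.integrand (fun z => W (fun j : Fin k => z (Fin.natAdd (m + 2) j)) *
          (2 * lam (fun j : Fin k => z (Fin.natAdd (m + 2) j)) /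
            ((1 - ∏ i : Fin (m + 2), z (Fin.castAdd k i)) ^ 2 +
              (lam (fun j : Fin k => z (Fin.natAdd (m + 2) j))) ^ 2 *
                (1 + ∏ i : Fin (m + 2), z (Fin.castAdd k i)) ^ 2))) r.domain →
        ∃ (r₂ : KZ.IntegralRep (m + 1 + (k + 1))),
          r₂.domain = {z | (∀ i : Fin (m + 1), z (Fin.castAdd (k + 1) i) ∈ Set.Ioo (0:ℝ) 1) ∧
            (fun j : Fin k => z (Fin.natAdd (m + 1) j.succ)) ∈ D ∧
            0 < z (Fin.natAdd (m + 1) 0) ∧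
            z (Fin.natAdd (m + 1) 0) < lam ((fun j : Fin k => z (Fin.natAdd (m + 1) j.succ)))} ∧
          (r₂.integrand = fun z => W ((fun j : Fin k => z (Fin.natAdd (m + 1) j.succ))) *
            (2 / (1 + (z (Fin.natAdd (m + 1) 0)) ^ 2)) *
            (((1 - ∏ i : Fin (m + 1), z (Fin.castAdd (k + 1) i)) -
                (z (Fin.natAdd (m + 1) 0)) ^ 2 * (1 + ∏ i : Fin (m + 1), z (Fin.castAdd (k + 1) i))) /
              ((1 - ∏ i : Fin (m + 1), z (Fin.castAdd (k + 1) i)) ^ 2 +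
                (z (Fin.natAdd (m + 1) 0)) ^ 2 * (1 + ∏ i : Fin (m + 1), z (Fin.castAdd (k + 1) i)) ^ 2))) ∧
          KZ.of r - KZ.of r₂ ∈ KZ.relations)) →
    -- S2a (arcs and chains), verbatim
    ((∀ (a j₀ j₁ L : ℕ), j₀ < j₁ → 2 * j₁ < L → ∀ (r : KZ.IntegralRep a),
      r.domain = {y | (∀ i, Real.tan (Real.pi * j₀ / L) < y i ∧ y i < Real.tan (Real.pi * j₁ / L)) ∧
        (∀ i i' : Fin a, i < i' → y i < y i')} →
      Set.EqOn r.integrand (fun y => ∏ i, 2 / (1 + (y i) ^ 2)) r.domain →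
      ∃ q : ℚ, ∀ (s : KZ.IntegralRep a), s.domain = {x | ∀ i, x i ∈ Set.Ioo (0:ℝ) 1} →
        Set.EqOn s.integrand (fun x => (q : ℝ) * ∏ i, 2 / (1 + (x i) ^ 2)) s.domain →
        KZ.Equivalent r s) ∧
    (∀ (r : KZ.IntegralRep 1), r.domain = {z | 0 < z 0} →
      Set.EqOn r.integrand (fun z => 1 / (1 + (z 0) ^ 2)) r.domain →
      ∀ (s : KZ.IntegralRep 1), s.domain = {x | ∀ i, x i ∈ Set.Ioo (0:ℝ) 1} →
        Set.EqOn s.integrand (fun x => ∏ i, 2 / (1 + (x i) ^ 2)) s.domain →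
        KZ.Equivalent r s)) →
    -- S2b (bottom cell), conclusion verbatim
    (∀ (k j L : ℕ), 0 < j → 2 * j < L → ∀ (r : KZ.IntegralRep (1 + (k + 1))),
      r.domain = {z | z (Fin.castAdd (k + 1) 0) ∈ Set.Ioo (0:ℝ) 1 ∧
        (∀ i : Fin (k + 1), 0 < z (Fin.natAdd 1 i) ∧ z (Fin.natAdd 1 i) < Real.tan (Real.pi * j / L)) ∧
        (∀ i i' : Fin (k + 1), i < i' → z (Fin.natAdd 1 i) < z (Fin.natAdd 1 i'))} →
      Set.EqOn r.integrand (fun z => (∏ i : Fin (k + 1), 2 / (1 + (z (Fin.natAdd 1 i)) ^ 2)) *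
        (2 * z (Fin.natAdd 1 0) /
          ((1 - z (Fin.castAdd (k + 1) 0)) ^ 2 +
            (z (Fin.natAdd 1 0)) ^ 2 * (1 + z (Fin.castAdd (k + 1) 0)) ^ 2))) r.domain →
      ∃ q : ℚ, ∀ (s : KZ.IntegralRep (1 + (k + 1))), s.domain = {x | ∀ i, x i ∈ Set.Ioo (0:ℝ) 1} →
        Set.EqOn s.integrand (fun x => (q : ℝ) * ∏ i, 2 / (1 + (x i) ^ 2)) s.domain →
        KZ.Equivalent r s) →
    -- conclusion: the four descents
    (∀ (w j L : ℕ), 2 ≤ w → Even w → 0 < j → 2 * j < L → ∀ (r : KZ.IntegralRep w),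
      r.domain = {x | ∀ i, x i ∈ Set.Ioo (0:ℝ) 1} →
      Set.EqOn r.integrand (fun x =>
        ((1 - ∏ i, x i) - (Real.tan (Real.pi * j / L)) ^ 2 * (1 + ∏ i, x i)) /
          ((1 - ∏ i, x i) ^ 2 + (Real.tan (Real.pi * j / L)) ^ 2 * (1 + ∏ i, x i) ^ 2)) r.domain →
      ∃ q : ℚ, ∀ (s : KZ.IntegralRep w), s.domain = {x | ∀ i, x i ∈ Set.Ioo (0:ℝ) 1} →
        Set.EqOn s.integrand (fun x => (q : ℝ) * ∏ i, 2 / (1 + (x i) ^ 2)) s.domain →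
        KZ.Equivalent r s) ∧
    (∀ (w j L : ℕ), 3 ≤ w → Odd w → 0 < j → 2 * j < L → ∀ (r : KZ.IntegralRep w),
      r.domain = {x | ∀ i, x i ∈ Set.Ioo (0:ℝ) 1} →
      Set.EqOn r.integrand (fun x =>
        2 * Real.tan (Real.pi * j / L) /
          ((1 - ∏ i, x i) ^ 2 + (Real.tan (Real.pi * j / L)) ^ 2 * (1 + ∏ i, x i) ^ 2)) r.domain →
      ∃ q : ℚ, ∀ (s : KZ.IntegralRep w), s.domain = {x | ∀ i, x i ∈ Set.Ioo (0:ℝ) 1} →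
        Set.EqOn s.integrand (fun x => (q : ℝ) * ∏ i, 2 / (1 + (x i) ^ 2)) s.domain →
        KZ.Equivalent r s) ∧
    (∀ (w : ℕ), 2 ≤ w → Even w → ∀ (r : KZ.IntegralRep w),
      r.domain = {x | ∀ i, x i ∈ Set.Ioo (0:ℝ) 1} →
      Set.EqOn r.integrand (fun x => 1 / (1 - ∏ i, x i)) r.domain →
      ∃ q : ℚ, ∀ (s : KZ.IntegralRep w), s.domain = {x | ∀ i, x i ∈ Set.Ioo (0:ℝ) 1} →
        Set.EqOn s.integrand (fun x => (q : ℝ) * ∏ i, 2 / (1 + (x i) ^ 2)) s.domain →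
        KZ.Equivalent r s) ∧
    (∀ (w : ℕ), 2 ≤ w → Even w → ∀ (r : KZ.IntegralRep w),
      r.domain = {x | ∀ i, x i ∈ Set.Ioo (0:ℝ) 1} →
      Set.EqOn r.integrand (fun x => 1 / (1 + ∏ i, x i)) r.domain →
      ∃ q : ℚ, ∀ (s : KZ.IntegralRep w), s.domain = {x | ∀ i, x i ∈ Set.Ioo (0:ℝ) 1} →
        Set.EqOn s.integrand (fun x => (q : ℝ) * ∏ i, 2 / (1 + (x i) ^ 2)) s.domain →
        KZ.Equivalent r s) := by
  rintro ⟨hT, hU⟩ ⟨hA1, -⟩ hBot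
  refine ⟨?_, ?_, ?_, ?_⟩
  · -- (C1): `w = N + 2`, `N` even
    intro w j L hw hwe hj hjL
    obtain ⟨N, rfl⟩ : ∃ N, w = N + 2 := ⟨w - 2, by omega⟩
    have hN : Even N := by obtain ⟨t, ht⟩ := hwe; exact ⟨t - 1, by omega⟩
    exact LadderDescent.wf_T hT hU hA1 hBot N hN j L hj hjL
  · -- (C2): the registered sub-goal `ladderDescent_uBoxes` over the T-objects (`step_T`)
    exact ladderDescent_uBoxes hU fun N hN =>
      LadderDescent.step_T hT hA1 N (LadderDescent.wf_zeta hT hU hA1 hBot N hN)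
        (LadderDescent.wf_uObjects hT hU hA1 hBot N hN)
  · -- (C3): `w = N + 2`, `N` even
    intro w hw hwe
    obtain ⟨N, rfl⟩ : ∃ N, w = N + 2 := ⟨w - 2, by omega⟩
    have hN : Even N := by obtain ⟨t, ht⟩ := hwe; exact ⟨t - 1, by omega⟩
    exact LadderDescent.wf_zeta hT hU hA1 hBot N hN
  · -- (C4): from (C3) by the level-4 dilation algebra (`conc_inv`)
    intro w hw hwe
    obtain ⟨N, rfl⟩ : ∃ N, w = N + 2 := ⟨w - 2, by omega⟩
    have hN : Even N := by obtain ⟨t, ht⟩ := hwe; exact ⟨t - 1, by omega⟩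
    exact LadderDescent.conc_inv (N + 2) hw (LadderDescent.wf_zeta hT hU hA1 hBot N hN)

end Summit.KontsevichZagierPeriods.Theorems.HurwitzMicroSectorsHurwitzSectorComplement

end
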